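import Summits.ABC.ABC.Theses.TwistAmplification
import Literature.NumberTheory.EllipticCurves.ModularCurve
import Literature.NumberTheory.EllipticCurves.GlobalMinimalModel
import Literature.NumberTheory.EllipticCurves.NewformPeterssonSize
import Literature.NumberTheory.EllipticCurves.SilvermanHeightCovolume
import Literature.NumberTheory.DiophantineGeometry.LocalReduction

/-!
Sketch for crux-ideate stmt-ABC-1976 (SomeWindowSaving), ideator 2, round 1.
First lemmas of the idea cards, stated as Props over existing declarations (not proved here).
-/

noncomputable section

namespace Summit.ABC.ABC.Cruxes.SomeWindowSaving.Ideas

open IsDedekindDomain WeierstrassCurve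
open Literature.NumberTheory.EllipticCurves Literature.NumberTheory.EllipticCurves.ModularForms
open Summit.ABC.ABC.Theses.TwistAmplification

/-- C⁺ of card `inert-box-collapse`: WEAK generalized Szpiro in the `∃ K` form, over minimal
integral models (same predicate vocabulary as the crux; all curves, CM-j included). -/
def WeakGeneralizedSzpiro : Prop :=
  ∃ K C : ℝ, ∀ W₀ : WeierstrassCurve ℤ, (W₀.baseChange ℚ).IsElliptic →
    (∀ v : HeightOneSpectrum ℤ, (W₀.baseChange ℚ).IsMinimalAt v) →
      ((max |W₀.Δ| (|W₀.c₄| ^ 3) : ℤ) : ℝ) ≤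
        C * (((W₀.baseChange ℚ).conductorNorm ℤ : ℕ) : ℝ) ^ K

/-- Cofinite, non-CM-j form (the output shape of route item `TwistAmplificationLemma`). -/
def CofiniteWeakGeneralizedSzpiro : Prop :=
  ∃ K N₀ : ℝ, ∀ W₀ : WeierstrassCurve ℤ, (W₀.baseChange ℚ).IsElliptic →
    (∀ v : HeightOneSpectrum ℤ, (W₀.baseChange ℚ).IsMinimalAt v) → W₀.c₄ ≠ 0 → W₀.c₆ ≠ 0 →
      N₀ ≤ (((W₀.baseChange ℚ).conductorNorm ℤ : ℕ) : ℝ) →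
        ((max |W₀.Δ| (|W₀.c₄| ^ 3) : ℤ) : ℝ) ≤ (((W₀.baseChange ℚ).conductorNorm ℤ : ℕ) : ℝ) ^ K

/-- FIRST LEMMA of card `inert-box-collapse` (elementary; no Shafarevich finiteness):
take `κ := K + 1`, `σ := K + 2`, `δ := 0 < 1/(2K−2)`; a window curve has `N^{K+1} ≤ M⁺ ≤ C N^K`, so
`N ≤ C`, so `M⁺ ≤ C^{K+1}`, so `|c₄|, |c₆|` are bounded and only finitely many reduced minimal
models occur: the count is bounded uniformly in `X`. -/
def InertBox : Prop := WeakGeneralizedSzpiro → SomeWindowSaving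

/-- The collapse in the other direction is the route's own support item 1978 read at `σ' := σ + 1`:
the crux implies cofinite weak generalized Szpiro. Together: the crux IS weak generalized Szpiro. -/
def Collapse : Prop :=
  QuadraticTwistInvariants → TwistAmplificationLemma → SomeWindowSaving → CofiniteWeakGeneralizedSzpiro

/-- C⁺ of card `polynomial-degree-suffices`: a POLYNOMIAL modular-degree bound with SOME exponent
`A` (not `2 + ε`) for semistable curves, in the parametrisation-datum form of routes
IsogenyGlueCongruence / DefiniteXi (`∃ D` form, Manin constant made explicit by `c²`). -/
def PolyModularDegree : Prop :=
  ∃ A C : ℝ, ∀ (W : WeierstrassCurve ℚ) [W.IsElliptic] [W.IsGloballyMinimal]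
    [NeZero (W.conductorNorm ℤ)], W.IsSemistable ℤ →
      ∃ D : ModularParametrizationData W (W.conductorNorm ℤ),
        (D.deg : ℝ) ≤ C * (D.c : ℝ) ^ 2 * (((W.conductorNorm ℤ : ℕ)) : ℝ) ^ A

/-- Weak generalized Szpiro for semistable curves over `ℚ`, global-minimal-model form. -/
def WeakSzpiroSemistable : Prop :=
  ∃ K C : ℝ, ∀ (W : WeierstrassCurve ℚ) [W.IsElliptic] [W.IsGloballyMinimal], W.IsSemistable ℤ →
    ((max |W.Δ| (|W.c₄| ^ 3) : ℚ) : ℝ) ≤ C * (((W.conductorNorm ℤ : ℕ)) : ℝ) ^ K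

/-- FIRST LEMMA of card `polynomial-degree-suffices` (Frey–Murty–Zagier with an inert exponent):
Zagier `4π²c²(f,f) = deg · covol Λ` (proved: `zagier_degree_formula_holds`) + `(f,f) ≫ N^{1−ε}`
(named fact) give `covol Λ ≥ κ N^{−(A−1+ε)}`; Silverman's covolume inequality (named fact) gives
`max(|Δ|,|c₄|³) ≤ A' N^{(6+ε)(A−1+ε)}`: weak Szpiro with `K = 6(A−1) + O(ε)`. Pattern of the in-tree
`covolume_ge_of_deg_le` with `2 + δ` replaced by `A`. -/
def PolyDegreeGivesWeakSzpiro : Prop :=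
  murty_petersson_newform_lower_bound → silverman1986_discriminant_c4_covolume →
    PolyModularDegree → WeakSzpiroSemistable

/-- FACE 1 any proof of the crux cuts (via the in-tree minimal Frey models of `(1, n, n+1)`,
`exists_minimal_frey_model`: `N ∣ 2^10 rad`, `c² ≤ 2|c₄|`): a POWER lower bound for the radical of
two consecutive integers — open (Stewart–Yu give only `rad(n(n+1)) ≫ (log n)^{3−o(1)}`). -/
def ConsecutiveRadicalPower : Prop :=
  ∃ δ C : ℝ, 0 < δ ∧ 0 < C ∧ ∀ n : ℕ, 1 ≤ n →
    (n : ℝ) ^ δ ≤ C * ((Literature.NumberTheory.DiophantineGeometry.rad 1 n (n + 1) : ℕ) : ℝ)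

/-- FACE 2 any proof of the crux cuts (curve `Y² = X³ − 3xX − 2y`: `c₄ = 144x`, `Δ = 1728(x³ − y²)`,
`N ≤ 2^8 3^5 rad(Δ)²`): WEAK HALL with a positive exponent for coprime pairs — open since Hall 1971
(Baker/Sprindžuk give only `|x³ − y²| ≫ (log |x|)^{c}`). -/
def WeakHallCoprime : Prop :=
  ∃ δ C : ℝ, 0 < δ ∧ 0 < C ∧ ∀ x y : ℤ, IsCoprime x y → x ^ 3 ≠ y ^ 2 →
    (|x| : ℝ) ^ δ ≤ C * (|x ^ 3 - y ^ 2| : ℝ)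

/-- The faces are necessary: both implications are elementary given in-tree Frey/conductor facts. -/
def Faces : Prop := WeakGeneralizedSzpiro → ConsecutiveRadicalPower ∧ WeakHallCoprime

/-- Card `polynomial-degree-suffices`, all-curves form (modularity holds for every `E/ℚ`; no
semistability needed for the Zagier–Petersson–Silverman bridge). -/
def PolyModularDegreeAll : Prop :=
  ∃ A C : ℝ, ∀ (W : WeierstrassCurve ℚ) [W.IsElliptic] [W.IsGloballyMinimal]
    [NeZero (W.conductorNorm ℤ)],
      ∃ D : ModularParametrizationData W (W.conductorNorm ℤ),
        (D.deg : ℝ) ≤ C * (D.c : ℝ) ^ 2 * (((W.conductorNorm ℤ : ℕ)) : ℝ) ^ A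

/-- Weak generalized Szpiro, global-minimal-model-over-`ℚ` form (bookkeeping-equivalent to
`WeakGeneralizedSzpiro`: `IsGloballyMinimal W ↔ W = W₀.baseChange ℚ` with `W₀` minimal at all `v`). -/
def WeakGeneralizedSzpiroQ : Prop :=
  ∃ K C : ℝ, ∀ (W : WeierstrassCurve ℚ) [W.IsElliptic] [W.IsGloballyMinimal],
    ((max |W.Δ| (|W.c₄| ^ 3) : ℚ) : ℝ) ≤ C * (((W.conductorNorm ℤ : ℕ)) : ℝ) ^ K

/-- FIRST LEMMA of card `polynomial-degree-suffices`, all-curves form. -/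
def PolyDegreeGivesWeakSzpiroAll : Prop :=
  murty_petersson_newform_lower_bound → silverman1986_discriminant_c4_covolume →
    PolyModularDegreeAll → WeakGeneralizedSzpiroQ

end Summit.ABC.ABC.Cruxes.SomeWindowSaving.Ideas

end
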